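import Literature.Computability.AlgebraicComplexity.BDS24ExponentialInterpolation
import Literature.Computability.AlgebraicComplexity.BorderComplexityInitialForms
import Literature.Barriers.ValiantsHypothesis.FSV18UniversalConstructions
import HarnessLib

/-!
# VP-boundary square — toric interpolation: exponential-weight slices of `VP` are `VNP` families

Decomp lens-3 (border / debordering axis), g10 node «toric arcs», ENGINE file (route-independent; the
rung corollaries in the route's vocabulary are in `Theorems/VPBoundarySquareToricSlices`).

For `f ∈ F[x_σ]`, weights `w ∈ ℕ^σ` and a target `b`, the weight slice
`weightedHomogeneousComponent w b f = Σ_{⟨w,m⟩ = b} c_m x^m` is, for `N = 2^t > b` and `N >` every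
weight on the support and `ω` a primitive `N`-th root of unity, the Boolean sum over `e ∈ {0,1}^t` of
the **toric interpolant**

  `g(x, e) = N^{-1} · Π_l (1 + e_l (ω^{(N-b) 2^l} - 1)) · f( …, Π_l (1 + e_l (ω^{w_j 2^l} - 1)) · x_j, … )`

(`boolSum_toricInterpolant`; the per-variable selector `Π_l (1 + e_l (ω^{w_j 2^l} - 1))` agrees with
`(ω^{i(e)})^{w_j}` on Boolean `e`, `i(e) = Σ_l e_l 2^l`, so the sum is the finite Fourier inversion
`N^{-1} Σ_{i<N} ω^{(N-b) i} f(ω^{i w} x)`), of size `L(g) ≤ L(f) + #σ (3t+1) + 3t + 2`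
(`complexity_toricInterpolant_le`) and — the point — of POLYNOMIAL degree `≤ t + deg f · (t+1)`
(`totalDegree_toricInterpolant_le`), whereas BDS24's `ε`-interpolant for the presentable class inherits
the exponential `ε`-degree and only reaches `VNPnb` (`IsPresVPBarFamily.isVNPnbFamily`). Hence
(★ `isVNPFamily_weightedHomogeneousComponent`): for a `VP` family `f` and weights/targets of
polynomial BIT-LENGTH (`< 2^{p(n)}`, exponential order of approximation) the slices form a `VNP`
family over `ℂ`.

IN PRINT this is known twice over — it is the toric (monomial-substitution) case of
Grochow–Mulmuley–Qiao 2016 Thm. 1(a)/Cor. 4.2 (`VP* ⊆ VNP* = VNP`; in the tree only the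
POLYNOMIAL-degree case `GMQ2016.isVNPFamily_of_isDegenerationOfDegree` is a theorem, the general case
sits behind the named fact `thm_1a_star`), and it also follows from Valiant's closure of `VNP` under
taking coefficients (Bürgisser 2024 Prop. 3.1; tree `IsVNPFamily.coeff` = ONE monomial per level)
combined with a p-bounded exponential sum over the exponentially many monomials of a slice. IN THE
KERNEL it is new: proved directly, without Valiant's criterion and without any named fact, in the
exponential-order regime that the polynomial-degree file does not reach.

References: Bhargav–Dwivedi–Saxena 2024 (STOC), Lemma 4.1 p. 13, §6 p. 16; Grochow–Mulmuley–Qiao 2016,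
§3.3, Thm. 1(a), Cor. 4.2; Bürgisser 2024 (arXiv:2406.06217) Prop. 3.1; Bürgisser 2000 Def. 2.1–2.5;
Forbes–Shpilka–Volk 2018 Lemma 3.3 (tree `FSV2018.totalDegree_bind₁_le_mul`).
-/

noncomputable section

set_option linter.dupNamespace false

open MvPolynomial Finset
open Literature.Computability.AlgebraicComplexity

namespace Summit.ValiantsHypothesis.ValiantsHypothesis.Theorems.VPBoundarySquareToricInterpolation

universe u v

/-! ### Orthogonality of characters of `μ_N` -/

section RootSums

/-- `Σ_{i<N} (ω^{N-b+d})^i = N·[d = b]` for `d, b < N` and `ω` a primitive `N`-th root of unity in a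
domain. [cite: BhargavDwivediSaxena2024, Lemma 4.1 (p. 13)] -/
theorem sum_pow_rootOfUnity_shift {R : Type*} [CommRing R] [IsDomain R] {ω : R} {N : ℕ}
    (hω : IsPrimitiveRoot ω N) {d b : ℕ} (hd : d < N) (hb : b < N) :
    ∑ i ∈ range N, (ω ^ (N - b + d)) ^ i = if d = b then (N : R) else 0 := by
  split_ifs with hdb
  · have h1 : ω ^ (N - b + d) = 1 := by
      rw [hdb, Nat.sub_add_cancel hb.le]
      exact hω.pow_eq_one
    rw [h1]
    simp
  · have hne : ω ^ (N - b + d) ≠ 1 := by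
      rw [Ne, hω.pow_eq_one_iff_dvd]
      intro hdvd
      have := Nat.eq_of_dvd_of_lt_two_mul (by omega) hdvd (by omega)
      omega
    have hpow : (ω ^ (N - b + d)) ^ N = 1 := by
      rw [← pow_mul, mul_comm, pow_mul, hω.pow_eq_one, one_pow]
    have key := geom_sum_mul (ω ^ (N - b + d)) N
    rw [hpow, sub_self] at key
    exact (mul_eq_zero.mp key).resolve_right (sub_ne_zero.mpr hne)

end RootSums

/-! ### Boolean cube bookkeeping (re-proved: the tree's versions are private) -/

section BoolCube

variable {F : Type u} [Field F] {σ : Type v}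

/-- Values in `Fin 2` of `finTwoEquiv.symm`. [folklore] -/
private theorem val_finTwoEquiv_symm' (b : Bool) :
    ((finTwoEquiv.symm b : Fin 2) : ℕ) = if b then 1 else 0 := by
  cases b <;> rfl

/-- Re-indexing a Boolean-cube sum by binary value. [folklore] -/
theorem sum_boolCube_eq_sum_range' {A : Type*} [AddCommMonoid A] (t : ℕ) (Φ : ℕ → A) :
    ∑ e : Fin t → Bool, Φ (binVal e) = ∑ i ∈ range (2 ^ t), Φ i := by
  let E : (Fin t → Bool) ≃ Fin (2 ^ t) :=
    (Equiv.arrowCongr (Equiv.refl (Fin t)) finTwoEquiv.symm).trans finFunctionFinEquiv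
  have hE : ∀ e : Fin t → Bool, ((E e : Fin (2 ^ t)) : ℕ) = binVal e := by
    intro e
    show ((finFunctionFinEquiv (finTwoEquiv.symm ∘ e ∘ (Equiv.refl (Fin t)).symm) : Fin (2 ^ t)) : ℕ)
      = binVal e
    rw [finFunctionFinEquiv_apply, binVal]
    refine sum_congr rfl fun j _ => ?_
    simp only [Function.comp_apply, Equiv.refl_symm, Equiv.refl_apply, val_finTwoEquiv_symm']
    split_ifs <;> simp
  rw [← Fin.sum_univ_eq_sum_range]
  exact Fintype.sum_equiv E _ _ fun e => by rw [hE]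

/-- The selector product `Π_j (1 + y_j (c^{2^j} - 1))` evaluates to `c^{binVal e}` at a Boolean
point. [cite: BhargavDwivediSaxena2024, §1.3 (p. 10)] -/
theorem aeval_boolPoint_selPow' (c : F) {t : ℕ} (e : Fin t → Bool) :
    aeval (Sum.elim X fun j => if e j then (1 : MvPolynomial σ F) else 0) (selPow (σ := σ) c t) =
      C (c ^ binVal e) := by
  unfold selPow binVal
  rw [map_prod, ← prod_pow_eq_pow_sum, map_prod]
  refine prod_congr rfl fun j _ => ?_
  by_cases h : e j
  · simp [h]
  · simp [h]

/-- Circuit size of the selector product: `≤ 3 t`. [folklore] -/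
theorem complexity_selPow_le' (c : F) (t : ℕ) : complexity (selPow (σ := σ) c t) ≤ 3 * t := by
  unfold selPow
  refine (complexity_finset_prod_le _ _).trans ?_
  have h : ∀ j ∈ (univ : Finset (Fin t)),
      complexity (1 + X (Sum.inr j) * C (c ^ 2 ^ (j : ℕ) - 1) : MvPolynomial (σ ⊕ Fin t) F) ≤ 2 := by
    intro j _
    calc complexity (1 + X (Sum.inr j) * C (c ^ 2 ^ (j : ℕ) - 1) : MvPolynomial (σ ⊕ Fin t) F)
        ≤ complexity (1 : MvPolynomial (σ ⊕ Fin t) F) +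
            complexity (X (Sum.inr j) * C (c ^ 2 ^ (j : ℕ) - 1) : MvPolynomial (σ ⊕ Fin t) F) + 1 :=
          complexity_add_le_holds _ _
      _ ≤ 0 + (0 + 0 + 1) + 1 := by
          gcongr
          · rw [← C_1, complexity_C_holds]
          · exact (complexity_mul_le_holds _ _).trans
              (by rw [complexity_X_holds, complexity_C_holds])
      _ = 2 := by norm_num
  calc ∑ j : Fin t, complexity (1 + X (Sum.inr j) * C (c ^ 2 ^ (j : ℕ) - 1) :
          MvPolynomial (σ ⊕ Fin t) F) + (univ : Finset (Fin t)).card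
      ≤ ∑ _j : Fin t, 2 + (univ : Finset (Fin t)).card :=
        Nat.add_le_add_right (sum_le_sum h) _
    _ = 3 * t := by
        simp only [sum_const, card_univ, Fintype.card_fin, smul_eq_mul]
        ring

/-- Degree of the selector product: `≤ t` (it is multilinear in `y`). [folklore] -/
theorem totalDegree_selPow_le (c : F) (t : ℕ) : (selPow (σ := σ) c t).totalDegree ≤ t := by
  unfold selPow
  refine (totalDegree_finsetProd _ _).trans ?_
  calc ∑ j : Fin t, (1 + X (Sum.inr j) * C (c ^ 2 ^ (j : ℕ) - 1) :
          MvPolynomial (σ ⊕ Fin t) F).totalDegree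
      ≤ ∑ _j : Fin t, 1 := sum_le_sum fun j _ => (totalDegree_add _ _).trans (max_le
          (by rw [totalDegree_one]; exact Nat.zero_le _)
          ((totalDegree_mul _ _).trans (by rw [totalDegree_X, totalDegree_C])))
    _ = t := by simp

end BoolCube

/-! ### The toric interpolant -/

section Toric

variable {F : Type u} [Field F] {σ : Type v}

/-! The **toric interpolant** of `f` for weights `w`, target `b` and `N = 2^t` is the polynomial
`g = N^{-1} · selPow (ω^{N-b}) t · f(…, selPow (ω^{w_j}) t · x_j, …) ∈ F[x_σ, y_1 … y_t]`, written out
in full in each statement below (no auxiliary definition): at a Boolean point `e` the selector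
products evaluate to `ω^{(N-b) i(e)}` and `ω^{w_j i(e)}`. -/

/-- Coefficients of the toric interpolant at a Boolean point `e` with binary value `i`:
`N^{-1} · c_m(f) · (ω^{N-b+⟨w,m⟩})^i`. [cite: BhargavDwivediSaxena2024, Lemma 4.1 (p. 13)] -/
theorem coeff_aeval_boolPoint_toricInterpolant (ω : F) (t : ℕ) (w : σ → ℕ) (b : ℕ)
    (f : MvPolynomial σ F) (e : Fin t → Bool) (m : σ →₀ ℕ) :
    coeff m (aeval (Sum.elim X fun j => if e j then (1 : MvPolynomial σ F) else 0)
      (C (((2 ^ t : ℕ) : F)⁻¹) * (selPow (ω ^ (2 ^ t - b)) t *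
        aeval (fun j : σ => selPow (σ := σ) (ω ^ w j) t * X (Sum.inl j)) f) :
        MvPolynomial (σ ⊕ Fin t) F)) =
    (((2 ^ t : ℕ) : F)⁻¹ * coeff m f) * (ω ^ (2 ^ t - b + Finsupp.weight w m)) ^ binVal e := by
  classical
  rw [map_mul, map_mul, aeval_C, algebraMap_eq, aeval_boolPoint_selPow', comp_aeval_apply]
  have hφ : (fun j : σ => aeval (Sum.elim X fun j => if e j then (1 : MvPolynomial σ F) else 0)
      (selPow (σ := σ) (ω ^ w j) t * X (Sum.inl j))) =
      fun j => C ((ω ^ w j) ^ binVal e) * X j := by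
    funext j
    rw [map_mul, aeval_boolPoint_selPow', aeval_X, Sum.elim_inl]
  rw [hφ, coeff_C_mul, coeff_C_mul, coeff_aeval_C_mul_X]
  have hprod : (m.prod fun j k => ((ω ^ w j) ^ binVal e) ^ k) = ω ^ (binVal e * Finsupp.weight w m) := by
    rw [Finsupp.prod, Finsupp.weight_apply, Finsupp.sum, mul_sum, ← prod_pow_eq_pow_sum]
    refine prod_congr rfl fun j _ => ?_
    rw [← pow_mul, ← pow_mul, smul_eq_mul]
    congr 1
    ring
  rw [hprod]
  have hsplit : (ω ^ (2 ^ t - b + Finsupp.weight w m)) ^ binVal e =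
      (ω ^ (2 ^ t - b)) ^ binVal e * ω ^ (binVal e * Finsupp.weight w m) := by
    rw [pow_add, mul_pow, ← pow_mul ω (Finsupp.weight w m) (binVal e),
      mul_comm (Finsupp.weight w m) (binVal e)]
  rw [hsplit]
  ring

/-- **Coefficients of the Boolean sum of the toric interpolant**: for `N = 2^t > b` and `N >` every
weight on the support of `f`, `c_m(Σ_e g(x,e)) = [⟨w,m⟩ = b] · c_m(f)`.
[cite: BhargavDwivediSaxena2024, Lemma 4.1 (p. 13)] -/
theorem coeff_boolSum_toricInterpolant {ω : F} {t b : ℕ} (hω : IsPrimitiveRoot ω (2 ^ t))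
    (w : σ → ℕ) (f : MvPolynomial σ F) (hb : b < 2 ^ t)
    (hdeg : ∀ m ∈ f.support, Finsupp.weight w m < 2 ^ t) (m : σ →₀ ℕ) :
    coeff m (boolSum (C (((2 ^ t : ℕ) : F)⁻¹) * (selPow (ω ^ (2 ^ t - b)) t *
        aeval (fun j : σ => selPow (σ := σ) (ω ^ w j) t * X (Sum.inl j)) f) :
        MvPolynomial (σ ⊕ Fin t) F)) =
      if Finsupp.weight w m = b then coeff m f else 0 := by
  classical
  haveI : NeZero (2 ^ t) := ⟨pow_ne_zero t two_ne_zero⟩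
  have hN : ((2 ^ t : ℕ) : F) ≠ 0 := (hω.neZero').out
  unfold boolSum
  rw [coeff_sum]
  simp_rw [coeff_aeval_boolPoint_toricInterpolant]
  rw [sum_boolCube_eq_sum_range' t
    (fun i => (((2 ^ t : ℕ) : F)⁻¹ * coeff m f) * (ω ^ (2 ^ t - b + Finsupp.weight w m)) ^ i), ← mul_sum]
  by_cases hm : m ∈ f.support
  · rw [sum_pow_rootOfUnity_shift hω (hdeg m hm) hb]
    split_ifs with h
    · rw [mul_assoc, mul_comm (coeff m f), ← mul_assoc, inv_mul_cancel₀ hN, one_mul]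
    · rw [mul_zero]
  · have h0 : coeff m f = 0 := by simpa [mem_support_iff] using hm
    rw [h0]
    simp

/-- ★ **The Boolean sum of the toric interpolant is the weight slice**:
`Σ_{e ∈ {0,1}^t} g(x, e) = weightedHomogeneousComponent w b f` for `N = 2^t > b`, `N >` all weights on
the support, `ω` a primitive `N`-th root of unity. [cite: BhargavDwivediSaxena2024, Lemma 4.1 (p. 13), toric variant] -/
theorem boolSum_toricInterpolant {ω : F} {t b : ℕ} (hω : IsPrimitiveRoot ω (2 ^ t))
    (w : σ → ℕ) (f : MvPolynomial σ F) (hb : b < 2 ^ t)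
    (hdeg : ∀ m ∈ f.support, Finsupp.weight w m < 2 ^ t) :
    boolSum (C (((2 ^ t : ℕ) : F)⁻¹) * (selPow (ω ^ (2 ^ t - b)) t *
        aeval (fun j : σ => selPow (σ := σ) (ω ^ w j) t * X (Sum.inl j)) f) :
        MvPolynomial (σ ⊕ Fin t) F) =
      weightedHomogeneousComponent w b f := by
  classical
  ext m
  rw [coeff_boolSum_toricInterpolant hω w f hb hdeg, coeff_weightedHomogeneousComponent]

/-- **Size of the toric interpolant**: `L(g) ≤ L(f) + #σ (3t+1) + 3t + 2`.
[cite: BhargavDwivediSaxena2024, Lemma 4.1 (p. 13: size(g̃) ≤ poly(s))] -/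
theorem complexity_toricInterpolant_le [Fintype σ] (ω : F) (t : ℕ) (w : σ → ℕ) (b : ℕ)
    (f : MvPolynomial σ F) :
    complexity (C (((2 ^ t : ℕ) : F)⁻¹) * (selPow (ω ^ (2 ^ t - b)) t *
        aeval (fun j : σ => selPow (σ := σ) (ω ^ w j) t * X (Sum.inl j)) f) :
        MvPolynomial (σ ⊕ Fin t) F) ≤
      complexity f + Fintype.card σ * (3 * t + 1) + 3 * t + 2 := by
  have hA : complexity (aeval (fun j : σ => selPow (σ := σ) (ω ^ w j) t * X (Sum.inl j)) f :
      MvPolynomial (σ ⊕ Fin t) F) ≤ complexity f + Fintype.card σ * (3 * t + 1) := by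
    refine (complexity_aeval_le _ _).trans (Nat.add_le_add_left ?_ _)
    calc ∑ j : σ, complexity (selPow (σ := σ) (ω ^ w j) t * X (Sum.inl j) :
            MvPolynomial (σ ⊕ Fin t) F)
        ≤ ∑ _j : σ, (3 * t + 1) := sum_le_sum fun j _ =>
          (complexity_mul_le_holds _ _).trans (by
            have h1 := complexity_selPow_le' (σ := σ) (ω ^ w j) t
            rw [complexity_X_holds]; omega)
      _ = Fintype.card σ * (3 * t + 1) := by simp [sum_const, card_univ]
  calc complexity (C (((2 ^ t : ℕ) : F)⁻¹) * (selPow (ω ^ (2 ^ t - b)) t *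
          aeval (fun j : σ => selPow (σ := σ) (ω ^ w j) t * X (Sum.inl j)) f))
      ≤ complexity (C (((2 ^ t : ℕ) : F)⁻¹) : MvPolynomial (σ ⊕ Fin t) F) +
          complexity (selPow (ω ^ (2 ^ t - b)) t *
            aeval (fun j : σ => selPow (σ := σ) (ω ^ w j) t * X (Sum.inl j)) f) + 1 :=
        complexity_mul_le_holds _ _
    _ ≤ 0 + (3 * t + (complexity f + Fintype.card σ * (3 * t + 1)) + 1) + 1 := by
        gcongr
        · exact (complexity_C_holds _).le
        · exact (complexity_mul_le_holds _ _).trans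
            (add_le_add (add_le_add (complexity_selPow_le' _ t) hA) le_rfl)
    _ = complexity f + Fintype.card σ * (3 * t + 1) + 3 * t + 2 := by ring

/-- **Degree of the toric interpolant**: `deg g ≤ t + deg f · (t + 1)` — POLYNOMIAL, unlike the
`ε`-interpolant of the presentable class whose degree carries `deg_ε`. [cite: ForbesShpilkaVolk2018, Lemma 3.3 (degree of a substitution)] -/
theorem totalDegree_toricInterpolant_le (ω : F) (t : ℕ) (w : σ → ℕ) (b : ℕ) (f : MvPolynomial σ F) :
    (C (((2 ^ t : ℕ) : F)⁻¹) * (selPow (ω ^ (2 ^ t - b)) t *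
        aeval (fun j : σ => selPow (σ := σ) (ω ^ w j) t * X (Sum.inl j)) f) :
        MvPolynomial (σ ⊕ Fin t) F).totalDegree ≤
      t + f.totalDegree * (t + 1) := by
  refine (totalDegree_mul _ _).trans ?_
  rw [totalDegree_C, zero_add]
  refine (totalDegree_mul _ _).trans (add_le_add (totalDegree_selPow_le _ _) ?_)
  exact Literature.Barriers.ValiantsHypothesis.FSV2018.totalDegree_bind₁_le_mul _ (t + 1)
    (fun j => (totalDegree_mul _ _).trans (by
      have := totalDegree_selPow_le (σ := σ) (ω ^ w j) t
      rw [totalDegree_X]; omega)) f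

/-- The weight slice has degree at most `deg f`. [folklore] -/
theorem totalDegree_weightedHomogeneousComponent_le' (w : σ → ℕ) (b : ℕ) (f : MvPolynomial σ F) :
    (weightedHomogeneousComponent w b f).totalDegree ≤ f.totalDegree := by
  classical
  refine Finset.sup_le fun m hm => le_totalDegree (s := m) ?_
  rw [mem_support_iff, coeff_weightedHomogeneousComponent] at hm
  rw [mem_support_iff]
  intro h0
  apply hm
  simp [h0]

/-- `⟨w, m⟩ ≤ K · |m|` when all weights are `≤ K`. [folklore] -/
theorem weight_le_mul_degree (w : σ → ℕ) {K : ℕ} (hw : ∀ j, w j ≤ K) (m : σ →₀ ℕ) :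
    Finsupp.weight w m ≤ K * (m.sum fun _ e => e) := by
  rw [Finsupp.weight_apply, Finsupp.sum, Finsupp.sum, mul_sum]
  refine sum_le_sum fun j _ => ?_
  rw [smul_eq_mul, mul_comm K]
  exact Nat.mul_le_mul_left _ (hw j)

end Toric

/-! ### ★ Exponential-weight slices of `VP` families are `VNP` families -/

section Families

variable {ς : ℕ → Type v} [∀ n, Fintype (ς n)]

/-- ★★ **Toric slices of `VP` are in `VNP` (GMQ16 Cor. 4.2, toric case — PROVED, fact-free)**: for a
`VP` family `f`, weights `w_n ∈ ℕ^{ς n}` and targets `b_n` of polynomial bit-length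
(`w_n(j), b_n < 2^{p(n)}`, `p` p-bounded — so the order of the degeneration is EXPONENTIAL), the family
of weight slices `n ↦ weightedHomogeneousComponent w_n b_n f_n` is in `VNP` over `ℂ`.
[cite: GrochowMulmuleyQiao2016, Cor. 4.2 (VP* ⊆ VNP), toric case] [cite: Burgisser2024Completeness, Prop. 3.1 (VNP closed under taking coefficients, Valiant 1982)] [cite: BhargavDwivediSaxena2024, Lemma 4.1 (p. 13)] -/
theorem isVNPFamily_weightedHomogeneousComponent {f : ∀ n, MvPolynomial (ς n) ℂ}
    (hf : IsVPFamily f) (w : ∀ n, ς n → ℕ) (b : ℕ → ℕ) {p : ℕ → ℕ} (hp : IsPBounded p)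
    (hw : ∀ n j, w n j < 2 ^ p n) (hb : ∀ n, b n < 2 ^ p n) :
    IsVNPFamily (fun n => weightedHomogeneousComponent (w n) (b n) (f n)) := by
  classical
  let D : ℕ → ℕ := fun n => (f n).totalDegree
  let t : ℕ → ℕ := fun n => p n + (D n + 1)
  have hD : IsPBounded D := hf.1.2
  have ht : IsPBounded t := IsPBounded.add_holds hp (IsPBounded.add_holds hD (IsPBounded.const 1))
  let ω : ℕ → ℂ := fun s => Complex.exp (2 * Real.pi * Complex.I / ((2 ^ s : ℕ) : ℂ))
  have hω : ∀ s, IsPrimitiveRoot (ω s) (2 ^ s) := fun s =>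
    Complex.isPrimitiveRoot_exp (2 ^ s) (pow_ne_zero s two_ne_zero)
  have hbt : ∀ n, b n < 2 ^ t n := fun n =>
    (hb n).trans_le (Nat.pow_le_pow_right (by norm_num) (Nat.le_add_right _ _))
  have hdeg : ∀ n, ∀ m ∈ (f n).support, Finsupp.weight (w n) m < 2 ^ t n := by
    intro n m hm
    have h1 : Finsupp.weight (w n) m ≤ 2 ^ p n * (m.sum fun _ e => e) :=
      weight_le_mul_degree _ (fun j => (hw n j).le) m
    have h2 : (m.sum fun _ e => e) ≤ D n := le_totalDegree hm
    have h3 : D n < 2 ^ (D n + 1) :=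
      (Nat.lt_two_pow_self (n := D n)).trans (Nat.pow_lt_pow_right (by norm_num) (Nat.lt_succ_self _))
    calc Finsupp.weight (w n) m ≤ 2 ^ p n * D n := h1.trans (Nat.mul_le_mul_left _ h2)
      _ < 2 ^ p n * 2 ^ (D n + 1) := Nat.mul_lt_mul_of_pos_left h3 (Nat.two_pow_pos _)
      _ = 2 ^ t n := by rw [← pow_add]
  have hPfam : IsPFamily (fun n => weightedHomogeneousComponent (w n) (b n) (f n)) :=
    ⟨hf.1.1, hD.mono fun n => totalDegree_weightedHomogeneousComponent_le' _ _ _⟩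
  refine ⟨hPfam, t, fun n => C (((2 ^ t n : ℕ) : ℂ)⁻¹) * (selPow (ω (t n) ^ (2 ^ t n - b n)) (t n) *
      aeval (fun j : ς n => selPow (σ := ς n) (ω (t n) ^ w n j) (t n) * X (Sum.inl j)) (f n)),
    ⟨⟨?_, ?_⟩, ?_⟩, fun n => (boolSum_toricInterpolant (hω (t n)) (w n) (f n) (hbt n) (hdeg n)).symm⟩
  · exact (IsPBounded.add_holds hf.1.1 ht).mono fun n => by simp [Fintype.card_sum]
  · exact (IsPBounded.add_holds ht (IsPBounded.mul_holds hD (IsPBounded.add_holds ht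
      (IsPBounded.const 1)))).mono fun n => totalDegree_toricInterpolant_le _ _ _ _ _
  · exact (IsPBounded.add_holds (IsPBounded.add_holds (IsPBounded.add_holds hf.2
      (IsPBounded.mul_holds hf.1.1 (IsPBounded.add_holds (IsPBounded.mul_holds (IsPBounded.const 3) ht)
        (IsPBounded.const 1)))) (IsPBounded.mul_holds (IsPBounded.const 3) ht))
      (IsPBounded.const 2)).mono fun n => complexity_toricInterpolant_le _ _ _ _ _

end Families

end Summit.ValiantsHypothesis.ValiantsHypothesis.Theorems.VPBoundarySquareToricInterpolation
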